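import Mathlib.Analysis.SpecialFunctions.Integrals.Basic
import Literature.Analysis.FunctionSpaces.ItoMartingale
import HarnessLib

/-!
# A concave `C²` modification of `log` below a level, and martingales `f(V) - ∫ (Lf)(V)` for unbounded Itô processes

Tools for the Koebe/log-derivative route to the named fact
`Literature.Probability.RandomPlanarGeometry.SLEKappaRho.ae_forall_ofReal_notMem_closure_hullUnion`
(`SLEKappaRhoFillVersion`), after

* S. Rohde, O. Schramm, *Basic properties of SLE*, Ann. of Math. **161** (2005), proof of
  Lemma 7.2 (p. 909): for the real SLE flow `X`, "a straightforward application of Itô's formula"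
  makes `log g_t'(x) + c log X_t` a local martingale;
* D. Revuz, M. Yor, *Continuous Martingales and Brownian Motion* (1999), Ch. IV, Thm (3.3).

To run that argument WITHOUT localisation along exit times (which would require everywhere
continuous paths in the tree's raw-filtration setting), `log` is replaced by a globally `C²`,
concave, non-decreasing function `logCut δ` equal to `log` on `[δ, ∞)`, with bounded derivative on
`[0, ∞)`:

* `SLEKappaRho.logCutDD δ v = -1/(max v δ)²` (the second derivative, continuous),
  `SLEKappaRho.logCutD δ v = 1/δ + ∫_δ^v logCutDD δ` (the first derivative: `1/v` on `[δ, ∞)`,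
  `(2δ - v)/δ²` below `δ`), `SLEKappaRho.logCut δ v = log δ + ∫_δ^v logCutD δ` (`= log v` on
  `[δ, ∞)`); `ContDiff ℝ 2`, `deriv`/`iteratedDeriv 2` computed, `0 ≤ logCutD ≤ 2/δ` on `[0, ∞)`,
  `logCutD` antitone, `logCut` monotone on `[0, ∞)`;
* `SLEKappaRho.logCutGen κ δ v = (2/v) logCutD δ v + (κ/2) logCutDD δ v` — the generator of the
  Bessel-type flow `dX = (2/X) dt - √κ dB` applied to `logCut δ`: `(2 - κ/2)/v²` on `[δ, ∞)`,
  `4/(δv) - (2 + κ/2)/δ²` on `(0, δ]`, ANTITONE on `(0, ∞)` for `κ ≤ 4` (`antitoneOn_logCutGen`);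
* `martingale_apply_sub_timeIntegral_of_deriv_bounded` — the variant of the tree's
  `Literature.Analysis.FunctionSpaces.martingale_apply_sub_timeIntegral` (Itô's formula:
  `f(V_t) - ∫₀ᵗ (b f'(V) + ½σ² f''(V)) ds` is a martingale) for a PROGRESSIVE Itô process `V` not
  confined to a compact interval, under a uniform bound on `f'(V_t)` instead (same proof).

No named fact is introduced.
-/

noncomputable section

open Set Filter Topology MeasureTheory intervalIntegral
open scoped NNReal

namespace Literature.Probability.RandomPlanarGeometry

/-! ### The cut-off logarithm -/

namespace SLEKappaRho

variable (δ : ℝ)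

/-- `logCutDD δ v = -1/(max v δ)²`: the second derivative of the cut-off logarithm. [folklore] -/
def logCutDD (v : ℝ) : ℝ := -1 / (max v δ) ^ 2

/-- `logCutD δ v = 1/δ + ∫_δ^v logCutDD δ`: the first derivative of the cut-off logarithm
(`1/v` on `[δ, ∞)`, `(2δ - v)/δ²` below `δ`). [folklore] -/
def logCutD (v : ℝ) : ℝ := 1 / δ + ∫ s in δ..v, logCutDD δ s

/-- **The cut-off logarithm** `logCut δ v = log δ + ∫_δ^v logCutD δ`: a `C²` concave non-decreasing
function on `ℝ`, equal to `log` on `[δ, ∞)`. [folklore] -/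
def logCut (v : ℝ) : ℝ := Real.log δ + ∫ s in δ..v, logCutD δ s

variable {δ}

/-- The **generator of the Bessel-type flow `dX = (2/X) dt - √κ dB` applied to `logCut δ`**:
`logCutGen κ δ v = (2/v) logCutD δ v + (κ/2) logCutDD δ v`. [cite: RohdeSchramm2005, proof of Lemma 7.2 (p. 909)] -/
def logCutGen (κ δ₀ v : ℝ) : ℝ := 2 / v * logCutD δ₀ v + κ / 2 * logCutDD δ₀ v

/-- `logCutDD δ v = -1/v²` for `v ≥ δ`. [folklore] -/
theorem logCutDD_of_le {v : ℝ} (h : δ ≤ v) : logCutDD δ v = -1 / v ^ 2 := by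
  rw [logCutDD, max_eq_left h]

/-- `logCutDD δ v = -1/δ²` for `v ≤ δ`. [folklore] -/
theorem logCutDD_of_ge {v : ℝ} (h : v ≤ δ) : logCutDD δ v = -1 / δ ^ 2 := by
  rw [logCutDD, max_eq_right h]

/-- `logCutDD ≤ 0`. [folklore] -/
theorem logCutDD_nonpos (δ v : ℝ) : logCutDD δ v ≤ 0 := by
  rw [logCutDD]
  exact div_nonpos_of_nonpos_of_nonneg (by norm_num) (sq_nonneg _)

/-- `|logCutDD δ v| ≤ 1/δ²` (`δ > 0`). [folklore] -/
theorem abs_logCutDD_le (hδ : 0 < δ) (v : ℝ) : |logCutDD δ v| ≤ 1 / δ ^ 2 := by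
  have hm : δ ≤ max v δ := le_max_right v δ
  have hm0 : 0 < max v δ := hδ.trans_le hm
  rw [logCutDD, abs_div, abs_neg, abs_one, abs_of_pos (pow_pos hm0 2)]
  exact one_div_le_one_div_of_le (pow_pos hδ 2) (pow_le_pow_left₀ hδ.le hm 2)

/-- `logCutDD δ` is continuous (`δ > 0`). [folklore] -/
theorem continuous_logCutDD (hδ : 0 < δ) : Continuous (logCutDD δ) := by
  unfold logCutDD
  refine continuous_const.div ((continuous_id.max continuous_const).pow 2) fun v ↦ ?_
  exact pow_ne_zero 2 (hδ.trans_le (le_max_right v δ)).ne'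

/-- `logCutD δ` has derivative `logCutDD δ`. [folklore] -/
theorem hasDerivAt_logCutD (hδ : 0 < δ) (v : ℝ) : HasDerivAt (logCutD δ) (logCutDD δ v) v := by
  unfold logCutD
  exact ((continuous_logCutDD hδ).integral_hasStrictDerivAt δ v).hasDerivAt.const_add _

/-- `deriv (logCutD δ) = logCutDD δ`. [folklore] -/
theorem deriv_logCutD (hδ : 0 < δ) : deriv (logCutD δ) = logCutDD δ :=
  funext fun v ↦ (hasDerivAt_logCutD hδ v).deriv

/-- `logCutD δ` is continuous. [folklore] -/
theorem continuous_logCutD (hδ : 0 < δ) : Continuous (logCutD δ) :=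
  continuous_iff_continuousAt.2 fun v ↦ (hasDerivAt_logCutD hδ v).continuousAt

/-- `logCut δ` has derivative `logCutD δ`. [folklore] -/
theorem hasDerivAt_logCut (hδ : 0 < δ) (v : ℝ) : HasDerivAt (logCut δ) (logCutD δ v) v := by
  unfold logCut
  exact ((continuous_logCutD hδ).integral_hasStrictDerivAt δ v).hasDerivAt.const_add _

/-- `deriv (logCut δ) = logCutD δ`. [folklore] -/
theorem deriv_logCut (hδ : 0 < δ) : deriv (logCut δ) = logCutD δ :=
  funext fun v ↦ (hasDerivAt_logCut hδ v).deriv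

/-- `iteratedDeriv 2 (logCut δ) = logCutDD δ`. [folklore] -/
theorem iteratedDeriv_two_logCut (hδ : 0 < δ) : iteratedDeriv 2 (logCut δ) = logCutDD δ := by
  rw [iteratedDeriv_succ, iteratedDeriv_one, deriv_logCut hδ, deriv_logCutD hδ]

/-- `logCutD δ` is `C¹`. [folklore] -/
theorem contDiff_logCutD (hδ : 0 < δ) : ContDiff ℝ 1 (logCutD δ) := by
  rw [show (1 : WithTop ℕ∞) = 0 + 1 by norm_num, contDiff_succ_iff_deriv]
  refine ⟨fun v ↦ (hasDerivAt_logCutD hδ v).differentiableAt, fun h ↦ ?_, ?_⟩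
  · exact absurd h (by simp)
  · rw [deriv_logCutD hδ]
    exact contDiff_zero.2 (continuous_logCutDD hδ)

/-- **`logCut δ` is `C²`** (`δ > 0`). [folklore] -/
theorem contDiff_logCut (hδ : 0 < δ) : ContDiff ℝ 2 (logCut δ) := by
  rw [show (2 : WithTop ℕ∞) = 1 + 1 by norm_num, contDiff_succ_iff_deriv]
  refine ⟨fun v ↦ (hasDerivAt_logCut hδ v).differentiableAt, fun h ↦ ?_, ?_⟩
  · exact absurd h (by simp)
  · rw [deriv_logCut hδ]
    exact contDiff_logCutD hδ

/-- **`logCutD δ v = 1/v` for `v ≥ δ`.** [folklore] -/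
theorem logCutD_of_le (hδ : 0 < δ) {v : ℝ} (h : δ ≤ v) : logCutD δ v = v⁻¹ := by
  unfold logCutD
  have hcongr : ∫ s in δ..v, logCutDD δ s = ∫ s in δ..v, -(s ^ 2)⁻¹ := by
    refine integral_congr fun s hs ↦ ?_
    rw [uIcc_of_le h] at hs
    rw [logCutDD_of_le hs.1, neg_div, one_div]
  have hderiv : ∀ s ∈ uIcc δ v, HasDerivAt (fun s : ℝ ↦ s⁻¹) (-(s ^ 2)⁻¹) s := by
    intro s hs
    rw [uIcc_of_le h] at hs
    exact hasDerivAt_inv (hδ.trans_le hs.1).ne'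
  have hint : IntervalIntegrable (fun s : ℝ ↦ -(s ^ 2)⁻¹) volume δ v := by
    refine (ContinuousOn.neg ?_).intervalIntegrable
    refine (continuousOn_pow 2).inv₀ fun s hs ↦ ?_
    rw [uIcc_of_le h] at hs
    exact pow_ne_zero 2 (hδ.trans_le hs.1).ne'
  rw [hcongr, integral_eq_sub_of_hasDerivAt hderiv hint, one_div]
  ring

/-- **`logCutD δ v = (2δ - v)/δ²` for `v ≤ δ`.** [folklore] -/
theorem logCutD_of_ge (hδ : 0 < δ) {v : ℝ} (h : v ≤ δ) : logCutD δ v = (2 * δ - v) / δ ^ 2 := by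
  unfold logCutD
  have hcongr : ∫ s in δ..v, logCutDD δ s = ∫ s in δ..v, -1 / δ ^ 2 := by
    refine integral_congr fun s hs ↦ ?_
    rw [uIcc_of_ge h] at hs
    exact logCutDD_of_ge hs.2
  rw [hcongr, intervalIntegral.integral_const, smul_eq_mul]
  field_simp
  ring

/-- **`logCut δ v = log v` for `v ≥ δ`.** [folklore] -/
theorem logCut_of_le (hδ : 0 < δ) {v : ℝ} (h : δ ≤ v) : logCut δ v = Real.log v := by
  unfold logCut
  have hv : 0 < v := hδ.trans_le h
  have hcongr : ∫ s in δ..v, logCutD δ s = ∫ s in δ..v, s⁻¹ := by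
    refine integral_congr fun s hs ↦ ?_
    rw [uIcc_of_le h] at hs
    exact logCutD_of_le hδ hs.1
  rw [hcongr, integral_inv_of_pos hδ hv, Real.log_div hv.ne' hδ.ne']
  ring

/-- `logCutD δ` is antitone (its derivative `logCutDD δ ≤ 0`). [folklore] -/
theorem antitone_logCutD (hδ : 0 < δ) : Antitone (logCutD δ) :=
  antitone_of_deriv_nonpos (fun v ↦ (hasDerivAt_logCutD hδ v).differentiableAt) fun v ↦ by
    rw [deriv_logCutD hδ]
    exact logCutDD_nonpos δ v

/-- `logCutD δ 0 = 2/δ`. [folklore] -/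
theorem logCutD_zero (hδ : 0 < δ) : logCutD δ 0 = 2 / δ := by
  rw [logCutD_of_ge hδ hδ.le]
  field_simp
  ring

/-- `0 ≤ logCutD δ v` (everywhere). [folklore] -/
theorem logCutD_nonneg (hδ : 0 < δ) (v : ℝ) : 0 ≤ logCutD δ v := by
  rcases le_total v δ with h | h
  · rw [logCutD_of_ge hδ h]
    exact div_nonneg (by linarith) (sq_nonneg δ)
  · rw [logCutD_of_le hδ h]
    exact inv_nonneg.2 (hδ.le.trans h)

/-- `logCutD δ v ≤ 2/δ` for `v ≥ 0`. [folklore] -/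
theorem logCutD_le (hδ : 0 < δ) {v : ℝ} (hv : 0 ≤ v) : logCutD δ v ≤ 2 / δ := by
  rw [← logCutD_zero hδ]
  exact antitone_logCutD hδ hv

/-- `|logCutD δ v| ≤ 2/δ` for `v ≥ 0`. [folklore] -/
theorem abs_logCutD_le (hδ : 0 < δ) {v : ℝ} (hv : 0 ≤ v) : |logCutD δ v| ≤ 2 / δ := by
  rw [abs_of_nonneg (logCutD_nonneg hδ v)]
  exact logCutD_le hδ hv

/-- **`logCut δ` is non-decreasing.** [folklore] -/
theorem monotone_logCut (hδ : 0 < δ) : Monotone (logCut δ) :=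
  monotone_of_deriv_nonneg (fun v ↦ (hasDerivAt_logCut hδ v).differentiableAt) fun v ↦ by
    rw [deriv_logCut hδ]
    exact logCutD_nonneg hδ v

/-! ### The generator -/

/-- The generator is continuous on `(0, ∞)`. [folklore] -/
theorem continuousOn_logCutGen (hδ : 0 < δ) (κ : ℝ) : ContinuousOn (logCutGen κ δ) (Ioi 0) := by
  have h1 := continuous_logCutD hδ
  have h2 := continuous_logCutDD hδ
  show ContinuousOn (fun v ↦ 2 / v * logCutD δ v + κ / 2 * logCutDD δ v) (Ioi 0)
  intro v hv
  have hv0 : v ≠ 0 := ne_of_gt hv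
  exact (((continuousAt_const.div continuousAt_id hv0).mul h1.continuousAt).add
    (continuousAt_const.mul h2.continuousAt)).continuousWithinAt

/-- **The generator above the level**: `logCutGen κ δ v = (2 - κ/2)/v²` for `v ≥ δ`
(Rohde–Schramm: `d log X = (2 - κ/2) X⁻² dt - X⁻¹ √κ dB`). [cite: RohdeSchramm2005, proof of Lemma 7.2 (p. 909)] -/
theorem logCutGen_of_le (hδ : 0 < δ) (κ : ℝ) {v : ℝ} (h : δ ≤ v) :
    logCutGen κ δ v = (2 - κ / 2) / v ^ 2 := by
  have hv : v ≠ 0 := (hδ.trans_le h).ne'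
  rw [logCutGen, logCutD_of_le hδ h, logCutDD_of_le h]
  field_simp
  ring

/-- **The generator below the level**: `logCutGen κ δ v = 4/(δ v) - (2 + κ/2)/δ²` for `0 < v ≤ δ`.
[folklore] -/
theorem logCutGen_of_ge (hδ : 0 < δ) (κ : ℝ) {v : ℝ} (hv : 0 < v) (h : v ≤ δ) :
    logCutGen κ δ v = 4 / (δ * v) - (2 + κ / 2) / δ ^ 2 := by
  rw [logCutGen, logCutD_of_ge hδ h, logCutDD_of_ge h]
  field_simp
  ring

/-- **The generator is antitone on `(0, ∞)` for `κ ≤ 4`** (it is `4/(δv) - const` on `(0, δ]` and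
`(2 - κ/2)/v²` on `[δ, ∞)`, both non-increasing, and continuous at `δ`). [folklore] -/
theorem antitoneOn_logCutGen (hδ : 0 < δ) {κ : ℝ} (hκ : κ ≤ 4) : AntitoneOn (logCutGen κ δ) (Ioi 0) := by
  have hlow : ∀ a b : ℝ, 0 < a → a ≤ b → b ≤ δ → logCutGen κ δ b ≤ logCutGen κ δ a := by
    intro a b ha hab hbδ
    rw [logCutGen_of_ge hδ κ ha (hab.trans hbδ), logCutGen_of_ge hδ κ (ha.trans_le hab) hbδ]
    have : 4 / (δ * b) ≤ 4 / (δ * a) :=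
      div_le_div_of_nonneg_left (by norm_num) (mul_pos hδ ha) (mul_le_mul_of_nonneg_left hab hδ.le)
    linarith
  have hup : ∀ a b : ℝ, δ ≤ a → a ≤ b → logCutGen κ δ b ≤ logCutGen κ δ a := by
    intro a b hδa hab
    have ha : 0 < a := hδ.trans_le hδa
    rw [logCutGen_of_le hδ κ hδa, logCutGen_of_le hδ κ (hδa.trans hab)]
    exact div_le_div_of_nonneg_left (by linarith) (pow_pos ha 2) (pow_le_pow_left₀ ha.le hab 2)
  intro a ha b _ hab
  rcases le_total b δ with hbδ | hδb
  · exact hlow a b ha hab hbδ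
  · rcases le_total a δ with haδ | hδa
    · exact (hup δ b le_rfl hδb).trans (hlow a δ ha haδ le_rfl)
    · exact hup a b hδa hab

end SLEKappaRho

/-! ### Martingales from Itô's formula for progressive Itô processes with a bounded `f'(V)` -/

section ItoMartingale

open Literature.Analysis.FunctionSpaces Literature.Probability.Process

variable {V b σ : ℝ≥0 → (ℝ≥0 → ℝ) → ℝ} {f : ℝ → ℝ} {c C₁ Cσ : ℝ}

/-- **`f(V_t) - ∫₀ᵗ (b f'(V) + ½σ² f''(V)) ds` is a martingale** for an Itô process
`V = V₀ + ∫ b ds + ∫ σ dB` (canonical Brownian motion, raw filtration) which is strongly adapted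
and PROGRESSIVELY MEASURABLE, starts at the constant `c`, has progressive drift `b` and
progressive diffusion coefficient `σ` bounded by `Cσ`, and `f ∈ C²(ℝ)` with `|f'(V_t(ω))| ≤ C₁`
for all `t, ω`. Same proof as the tree's `martingale_apply_sub_timeIntegral` (where `V` has
everywhere continuous paths confined to a compact interval): Itô's formula
(`ito_formula_itoProcess_ae_holds`) gives `f(V_t) = f(c) + ∫₀ᵗ(…) ds + K_t` a.s. with
`K = ∫ σ f'(V) dB` the square-integrable Itô integral of the bounded progressive integrand
`σ f'(V)`. [cite: RevuzYor1999, Ch. IV Thm (3.3) and Remark 1] -/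
theorem martingale_apply_sub_timeIntegral_of_deriv_bounded (hf : ContDiff ℝ 2 f)
    (hVa : StronglyAdapted brownianFiltration V) (hVprog : IsStronglyProgressive brownianFiltration V)
    (hb : IsStronglyProgressive brownianFiltration b)
    (hσ : IsStronglyProgressive brownianFiltration σ)
    (hV : IsItoProcess V b σ brownian brownianFiltration preWienerMeasure)
    (hV0 : ∀ ω, V 0 ω = c) (hfbd : ∀ t ω, |deriv f (V t ω)| ≤ C₁) (hσbd : ∀ t ω, |σ t ω| ≤ Cσ) :
    Martingale (fun t ω ↦ f (V t ω) - timeIntegral (fun s ω ↦ b s ω * deriv f (V s ω) +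
        2⁻¹ * σ s ω ^ 2 * iteratedDeriv 2 f (V s ω)) t ω) brownianFiltration preWienerMeasure := by
  haveI := isProbabilityMeasure_preWienerMeasure'
  set D : ℝ≥0 → (ℝ≥0 → ℝ) → ℝ := fun s ω ↦ b s ω * deriv f (V s ω) +
    2⁻¹ * σ s ω ^ 2 * iteratedDeriv 2 f (V s ω) with hDdef
  have hf1 : Continuous (deriv f) := hf.continuous_deriv (by norm_num)
  have hf2 : Continuous (iteratedDeriv 2 f) := hf.continuous_iteratedDeriv 2 le_rfl
  -- the integrand `σ f'(V)` is progressive and bounded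
  have hg : IsStronglyProgressive brownianFiltration (fun t ω ↦ σ t ω * deriv f (V t ω)) :=
    hσ.mul (IsStronglyProgressive.continuous_comp hVprog hf1)
  have hCσ : 0 ≤ Cσ := (abs_nonneg _).trans (hσbd 0 (fun _ ↦ 0))
  have hgbd : ∀ t ω, |σ t ω * deriv f (V t ω)| ≤ Cσ * C₁ := by
    intro t ω
    rw [abs_mul]
    exact mul_le_mul (hσbd t ω) (hfbd t ω) (abs_nonneg _) hCσ
  have hfin : ∀ t : ℝ≥0, ∫⁻ ω, (∫⁻ s in Set.Icc (0 : ℝ) t, ENNReal.ofReal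
      ((σ s.toNNReal ω * deriv f (V s.toNNReal ω)) ^ 2)) ∂preWienerMeasure ≠ ⊤ := by
    intro t
    have hle : ∀ ω : ℝ≥0 → ℝ, (∫⁻ s in Set.Icc (0 : ℝ) t, ENNReal.ofReal
        ((σ s.toNNReal ω * deriv f (V s.toNNReal ω)) ^ 2)) ≤
        ENNReal.ofReal ((Cσ * C₁) ^ 2) * volume (Set.Icc (0 : ℝ) t) := by
      intro ω
      rw [← setLIntegral_const]
      refine lintegral_mono fun s ↦ ENNReal.ofReal_le_ofReal ?_
      have h := hgbd s.toNNReal ω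
      rw [← sq_abs]
      exact pow_le_pow_left₀ (abs_nonneg _) h 2
    refine ne_top_of_le_ne_top ?_ (lintegral_mono hle)
    rw [lintegral_const, measure_univ, mul_one, Real.volume_Icc, sub_zero]
    exact ENNReal.mul_ne_top ENNReal.ofReal_ne_top ENNReal.ofReal_ne_top
  obtain ⟨K, hK, hKM, -⟩ := exists_isItoIntegral_of_sq_integrable hg hfin
  -- Itô's formula for the time-independent `f`
  have hf' : ContDiff ℝ 2 (Function.uncurry fun (_ : ℝ) (v : ℝ) ↦ f v) :=
    hf.comp contDiff_snd
  have hito := ito_formula_itoProcess_ae_holds (fun (_ : ℝ) (v : ℝ) ↦ f v) hf'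
    (fun t ↦ (hVa t).measurable) hσ hV hK
  -- the process `M` is strongly adapted
  have hDprog : IsStronglyProgressive brownianFiltration D := by
    have hσ2 : IsStronglyProgressive brownianFiltration fun s ω ↦ σ s ω ^ 2 := fun i ↦
      ((hσ i).measurable.pow_const 2).stronglyMeasurable
    exact (hb.mul (IsStronglyProgressive.continuous_comp hVprog hf1)).add
      (((isStronglyProgressive_const _ (2⁻¹ : ℝ)).mul hσ2).mul (IsStronglyProgressive.continuous_comp hVprog hf2))
  have hMadapt : StronglyAdapted brownianFiltration
      (fun t ω ↦ f (V t ω) - timeIntegral D t ω) := fun t ↦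
    (hf.continuous.comp_stronglyMeasurable (hVa t)).sub
      (adapted_timeIntegral hDprog t).stronglyMeasurable
  -- `M = f(c) + K` almost surely, for all times
  have hae : ∀ᵐ ω ∂preWienerMeasure, ∀ t,
      f (V t ω) - timeIntegral D t ω = f c + K t ω := by
    filter_upwards [hito] with ω hω t
    have h := hω t
    simp only [deriv_const, zero_add, hV0 ω] at h
    have hD : timeIntegral D t ω = ∫ s in (0 : ℝ)..t,
        (b s.toNNReal ω * deriv (fun v ↦ f v) (V s.toNNReal ω) +
          2⁻¹ * σ s.toNNReal ω ^ 2 * iteratedDeriv 2 (fun v ↦ f v) (V s.toNNReal ω)) := rfl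
    rw [hD, h]
    ring
  have hmart : Martingale (fun t ω ↦ f c + K t ω) brownianFiltration preWienerMeasure :=
    (martingale_const brownianFiltration preWienerMeasure (f c)).add hKM
  refine hmart.congr hMadapt fun t ↦ ?_
  filter_upwards [hae] with ω hω
  exact (hω t).symm

end ItoMartingale

end Literature.Probability.RandomPlanarGeometry

end
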